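import Literature.AnabelianGeometry.SemiGraphs.ThetaRayTypedFormSweep
import Literature.AnabelianGeometry.SemiGraphs.TemperedBranchStabilizerCard
import Literature.AnabelianGeometry.SemiGraphs.TemperedEscapeOfHeights
import Literature.AnabelianGeometry.SemiGraphs.TemperedPiBranchStabilizerImage
import Literature.AnabelianGeometry.SemiGraphs.TemperedPiBranchStabilizerRecentred
import Literature.AnabelianGeometry.SemiGraphs.TemperedPiPresentation
import Literature.AnabelianGeometry.SemiGraphs.TreeSystemFixedPointTopological
import Literature.AnabelianGeometry.SemiGraphs.FreeProPRankTwoGluing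
import HarnessLib

/-!
# The escaping procyclic compact subgroup of `π₁^temp(𝒢_θ)` is ITSELF a maximal compact subgroup
# (an explicit ANCHOR-FREE maximal compact; typed-form sweep, brick «EXOTIC-IS-C»)

Mochizuki, *Semi-graphs of anabelioids*, Publ. RIMS **42** (2006), §3, Theorem 3.7 (iii)/(iv), manuscript
pp. 40–41 [cite: MochizukiSemiAnbd2006, Thm 3.7(iv) p.41]; Rmk. 2.2.1 p. 24 (decomposition groups as images).

PROOF-ONLY file (abc-iut cell, layer L3, seat abc-iut-L3-d4 gen 4; label [typed-form audit, outside the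
[IUTchIII] Cor. 3.12 cone]; 0 definitions, no named fact).  At abc-iut-L3-d1's countermodel `𝒢_θ(p, n)` the
cell's ∀-countable typings of Thm 3.7 (iii)/(iv) fail (p442260, p443103) at the «escaping» compact subgroup
`C = closure⟨c⟩`, `c = lim_k z_k` (`z_k` the image of the edge generator in the decomposition group of the far
vertex `v_{k+1}`), and abc-iut-w6-d062's «anchored» programme (p448045/p449612) shows that at every locally
finite Thm-3.7 graph EVERYTHING of (iii)/(iv) holds away from ANCHOR-FREE compact subgroups.  This file gives the
first structural theorem about those: **`C` is itself a maximal compact subgroup** (procyclic, hence neither slim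
nor verticial) — abc-iut-w6-d063's «cardinality squeeze» (p442570, there a binder `hrigid`) made unconditional:

* if a compact `K ⊇ C`, then at every level `n` the elements of `K` fix a FAR vertex of the tree `𝔾̃_n` and an
  edge at it (w6-d063's geodesic lemma, re-derived here because the olean of p442570 is unavailable — OPS-L3-5);
* in the covering `𝒢_{∞,n}` that edge's branch is `brOf b y`, whose stabiliser in `Gal(𝒢_{∞,n}/𝒢)` is the
  CYCLIC image `ψ_y(Π_b) = ⟨ψ_y(b_* 1)⟩` (abc-iut-L3-d3's `CovObj.stab_brOf_iff` + `TemperedBranchStabilizerCard`);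
* its order is read on the edge point, is the same for both branches of the edge and for all points of a fibre,
  and for the far apartment edges equals `orderOf (ρ_n z_m) = orderOf (ρ_n c)` (`m ≥ N_n`);
* so `ρ_n(K) = ⟨ρ_n c⟩` for every `n`, whence `K ≤ closure⟨c⟩ = C` (`mem_topologicalClosure_of_forall_proj`).

Main results: `thetaRay_exists_isMaximalCompact_procyclic_forall_not_le_verticial_of_characters` (generic ray
of groups with a topologically cyclic edge group, NEGATIVE-MODULO binders as in p441714/p448544) and
`thetaRayFreeProP_exists_isMaximalCompact_procyclic` (at `𝒢_θ(p,n)`, every schedule `n_k → ∞`): a maximal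
compact subgroup of the canonical `π₁^temp(𝒢_θ)` which is the closure of a cyclic group and lies in no verticial
subgroup.  Erratum-grade, about the ∀-countable TYPING only; nothing of the IUT corpus is touched; no side taken.
-/

noncomputable section

namespace Literature.AnabelianGeometry.SemiGraphs

open CategoryTheory Filter Topology Multiplicative
open ProfiniteSemiGraph ProfiniteSemiGraph.GaloisLevelData

namespace ProfiniteSemiGraph

namespace VerticialLevelData

universe v u

variable {𝒢 : ProfiniteSemiGraph.{u}} {c : TemperedPiChart 𝒢} (D : VerticialLevelData.{v} 𝒢 c)

/-! ### Far fixed edges of a compact over-group of a height-escaping element (after abc-iut-w6-d063, p442570;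
re-derived privately: that module's olean is unavailable on the build lane) -/

/-- A compact subgroup fixes a vertex of every level tree (Lemma 1.8 (ii)(a)). [cite: MochizukiSemiAnbd2006, Lem. 1.8(ii) p.20] -/
private theorem exists_forall_mem_fixed_vertex_of_isCompact' (K : Subgroup c.G) (hK : IsCompact (K : Set c.G))
    (j : D.J) : ∃ y : (D.tree j).Vertex, ∀ k ∈ K, (D.act j k).hom.vertexMap y = y := by
  obtain ⟨y, hy⟩ := SemiGraph.exists_fixed_vertex_of_isCompact_over K hK (D.isTree j) (D.vertex j)
    (D.proj j) (D.act j) (D.isOpen_ker j) (D.act_over j)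
  exact ⟨y, fun k hk => hy ⟨k, hk⟩⟩

/-- The transition maps are over `𝔾`, on vertices. [cite: MochizukiSemiAnbd2006, Thm 3.7(iii) p.41] -/
private theorem proj_vertexMap_trans' ⦃i j : D.J⦄ (h : i ≤ j) (x : (D.tree j).Vertex) :
    (D.proj i).vertexMap ((D.trans h).vertexMap x) = (D.proj j).vertexMap x := by
  have e := congrArg (fun φ => SemiGraph.Hom.vertexMap φ x) (D.trans_over h)
  simpa only [SemiGraph.comp_vertexMap, Function.comp_apply] using e

/-- Two distinct common fixed vertices give a common fixed edge at the first one (Lemma 1.8 (ii)(b)).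
[cite: MochizukiSemiAnbd2006, Lem. 1.8(ii) p.20] -/
private theorem exists_forall_mem_fixed_edge_of_two_fixed_vertices' (K : Subgroup c.G) (j : D.J)
    {y w : (D.tree j).Vertex} (hne : y ≠ w) (hy : ∀ k ∈ K, (D.act j k).hom.vertexMap y = y)
    (hw : ∀ k ∈ K, (D.act j k).hom.vertexMap w = w) :
    ∃ b : (D.tree j).Branch, (D.tree j).abuts b = some y ∧
      ∀ k ∈ K, (D.act j k).hom.edgeMap ((D.tree j).edgeOf b) = (D.tree j).edgeOf b := by
  classical
  have hT := (D.isTree j).isTree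
  let p : (D.tree j).subdivision.Path (Sum.inl y) (Sum.inl w) :=
    (hT.connected (Sum.inl y) (Sum.inl w)).some.toPath
  have hall : ∀ k ∈ K, ∀ z ∈ p.1.support, SemiGraph.nodeMap (D.act j k) z = z := fun k hk =>
    SemiGraph.nodeMap_eq_self_of_isPath hT.isAcyclic (D.act j k) (by simp [hy k hk]) (by simp [hw k hk])
      p.1 p.2
  have key : ∀ (u u' : (D.tree j).Node) (q : (D.tree j).subdivision.Walk u u'), u ≠ u' →
      ∃ z ∈ q.support, (D.tree j).subdivision.Adj u z := by
    intro u u' q huu'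
    cases q with
    | nil => exact absurd rfl huu'
    | cons h q' => exact ⟨_, by simp, h⟩
  obtain ⟨z, hz, hadj⟩ := key _ _ p.1 (fun h => hne (Sum.inl_injective h))
  change (SimpleGraph.fromRel (D.tree j).NodeRel).Adj _ _ at hadj
  rw [SimpleGraph.fromRel_adj] at hadj
  obtain ⟨-, h | h⟩ := hadj
  · cases h
  · cases h
    rename_i b hb
    refine ⟨b, hb, fun k hk => ?_⟩
    have hfix : (D.act j k).hom.branchMap b = b := by
      have := hall k hk _ hz
      simpa only [SemiGraph.nodeMap_inr_inr, Sum.inr.injEq] using this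
    rw [← (D.act j k).hom.edgeOf_branchMap b, hfix]

/-- **Far fixed edge**: if `g ∈ K`, `K` compact, and the `g`-fixed vertices escape to large height along the
levels, then at every level and beyond every bound the elements of `K` fix a common vertex of large height and an
edge abutting to it (abc-iut-w6-d063's lemma). [cite: MochizukiSemiAnbd2006, Thm 3.7(iv) p.41] -/
private theorem exists_forall_mem_fixed_far_edge_of_heightEscape' (H : 𝒢.graph.Vertex → ℕ) (K : Subgroup c.G)
    (hK : IsCompact (K : Set c.G)) (g : c.G) (hg : g ∈ K)
    (hesc : ∀ N : ℕ, ∃ j : D.J, ∀ y : (D.tree j).Vertex, (D.act j g).hom.vertexMap y = y →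
      N ≤ H ((D.proj j).vertexMap y))
    (j : D.J) (N : ℕ) : ∃ (x : (D.tree j).Vertex) (b : (D.tree j).Branch),
      (D.tree j).abuts b = some x ∧ N ≤ H ((D.proj j).vertexMap x) ∧
      (∀ k ∈ K, (D.act j k).hom.vertexMap x = x) ∧
      ∀ k ∈ K, (D.act j k).hom.edgeMap ((D.tree j).edgeOf b) = (D.tree j).edgeOf b := by
  obtain ⟨y, hy⟩ := D.exists_forall_mem_fixed_vertex_of_isCompact' K hK j
  obtain ⟨j₁, hj₁⟩ := hesc (max N (H ((D.proj j).vertexMap y) + 1))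
  obtain ⟨j₂, hjj₂, hj₁j₂⟩ := exists_ge_ge j j₁
  obtain ⟨y₂, hy₂⟩ := D.exists_forall_mem_fixed_vertex_of_isCompact' K hK j₂
  have hgt : max N (H ((D.proj j).vertexMap y) + 1) ≤ H ((D.proj j₂).vertexMap y₂) := by
    have hfix₁ : (D.act j₁ g).hom.vertexMap ((D.trans hj₁j₂).vertexMap y₂) =
        (D.trans hj₁j₂).vertexMap y₂ := by
      rw [← D.trans_act_vertexMap, hy₂ g hg]
    have h1 := hj₁ _ hfix₁
    rwa [D.proj_vertexMap_trans'] at h1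
  set w : (D.tree j).Vertex := (D.trans hjj₂).vertexMap y₂ with hw_def
  have hw : ∀ k ∈ K, (D.act j k).hom.vertexMap w = w := fun k hk => by
    rw [hw_def, ← D.trans_act_vertexMap, hy₂ k hk]
  have hHw : H ((D.proj j).vertexMap w) = H ((D.proj j₂).vertexMap y₂) := by
    rw [hw_def, D.proj_vertexMap_trans']
  have hne : w ≠ y := by
    intro h
    have h' := congrArg (fun x => H ((D.proj j).vertexMap x)) h
    simp only [hHw] at h'
    omega
  obtain ⟨b, hb, hfix⟩ := D.exists_forall_mem_fixed_edge_of_two_fixed_vertices' K j hne hw hy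
  exact ⟨w, b, hb, by rw [hHw]; omega, hw, hfix⟩

end VerticialLevelData

end ProfiniteSemiGraph

/-! ### The theta ray of groups: the escaping procyclic compact is maximal compact -/

section Generic

variable {G E : Type} [Group G] [TopologicalSpace G] [IsTopologicalGroup G] [CompactSpace G]
  [TotallyDisconnectedSpace G] [Group E] [TopologicalSpace E] [IsTopologicalGroup E] [CompactSpace E]
  [TotallyDisconnectedSpace E] {up : E →ₜ* G} {low : ℕ → (E →ₜ* G)}
  {A V : ℕ → Type} [∀ n, CommGroup (A n)] [∀ n, TopologicalSpace (A n)] [∀ n, DiscreteTopology (A n)]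
  [∀ n, Finite (A n)] [∀ n, CommGroup (V n)]

/-- **The escaping procyclic compact subgroup of `π₁^temp(𝒢_θ)` is a MAXIMAL compact subgroup lying in no
verticial subgroup**, for a ray of groups whose edge group is topologically generated by the chosen `e₀`
(binders as in abc-iut-L3-d4's `thetaRay_not_compactInVerticialAt_of_characters`, p441714, plus `hgen`).
NEGATIVE-MODULO form. [cite: MochizukiSemiAnbd2006, Thm 3.7(iv) p.41] -/
theorem thetaRay_exists_isMaximalCompact_procyclic_forall_not_le_verticial_of_characters
    (h37 : (thetaRay G E up low).Thm37Hypotheses)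
    (P₀ : ((thetaRay G E up low).galoisLevelData h37.toProp36Hypotheses).PointSeq h37.isCountable (0 : ℕ))
    (e₀ : E) (hgen : (Subgroup.zpowers e₀).topologicalClosure = ⊤)
    (hcoin : ∀ d : ℕ, ∃ N : ℕ, ∀ k, N ≤ k → (low (k + 1) e₀)⁻¹ * up e₀ ∈ charOpenCore G d)
    (χG : ∀ n, G →ₜ* A n) (hχA : ∀ (n k : ℕ) (t : E), χG n (low k t) = χG n (up t))
    (ab : ∀ n, G →* V n)
    (hK : ∀ n : ℕ, ∃ j₀ : ℕ, ∀ j, j₀ ≤ j → ∀ (w : ℕ)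
      (P : ((thetaRay G E up low).galoisLevelData h37.toProp36Hypotheses).PointSeq h37.isCountable w)
      (x : G), P.gal j x = 1 → ab n x = 1)
    (hsep : ∀ (n : ℕ) (t₁ t₂ : E), χG n (low (n + 1) t₁) = χG n (up e₀) → χG n (up t₂) = χG n (up e₀) →
      ab n (low (n + 1) t₁) ≠ ab n (up t₂)) :
    ∃ C : Subgroup ((thetaRay G E up low).temperedPiChart h37.toProp36Hypotheses).G,
      IsMaximalCompactSubgroup C ∧
      (∃ c, C = (Subgroup.zpowers c).topologicalClosure) ∧
      ∀ (v : ℕ) (H : Subgroup ((thetaRay G E up low).temperedPiChart h37.toProp36Hypotheses).G),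
        H ∈ verticialSubgroups ((thetaRay G E up low).temperedPiChart h37.toProp36Hypotheses) v → ¬ C ≤ H := by
  classical
  -- abbreviations
  set T : ProfiniteSemiGraph.{0} := thetaRay G E up low
  have h36 : T.Prop36Hypotheses := h37.toProp36Hypotheses
  set Dg : GaloisLevelData T := T.galoisLevelData h36
  have hc := h36.isCountable
  let Vd := verticialLevelData_temperedPiChart (h36 := h36)
  -- the edge generators `z_k` and their level data
  obtain ⟨hz, hfin, hfar⟩ := thetaRay_levelEscape_data h36 P₀ e₀ hcoin
  have hcrit := thetaRay_hcrit_of_characters h36 P₀ e₀ χG hχA ab hK hsep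
  set z : ℕ → Dg.temperedPi hc := fun k =>
    (rayPointSeq (D := Dg) thetaRay_ham thetaRay_hap thetaRay_hmp P₀ (k + 1)).decompHom
      (T.brHom (k, true) (k + 1) (thetaRay_hap k) e₀) with hzdef
  -- the limit `c := lim z_k` and the compact `C := closure⟨c⟩`
  obtain ⟨c, hcN⟩ := Dg.exists_forall_eventually_projAut_eq hc z hz
  choose N hN using hcN
  have hford : ∀ j, IsOfFinOrder (Dg.projAut hc j c) := fun j => by
    rw [hN j (N j) le_rfl]; exact hfin j (N j)
  have hC : IsCompact ((Subgroup.zpowers c).topologicalClosure : Set (Dg.temperedPi hc)) :=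
    Dg.isCompact_topologicalClosure_zpowers hc c hford
  have hcC : c ∈ (Subgroup.zpowers c).topologicalClosure :=
    Subgroup.le_topologicalClosure _ (Subgroup.mem_zpowers c)
  have hact : ∀ j k, N j ≤ k → Dg.treeAct hc j c = Dg.treeAct hc j (z k) := fun j k hk => by
    rw [Dg.treeAct_apply hc, Dg.treeAct_apply hc]
    exact congrArg _ (hN j k hk)
  -- hfar / hcrit for `c`
  have hfar_c : ∀ (j : Vd.J) (n : ℕ), ∃ x : (Vd.tree j).Vertex,
      n ≤ (fun v : ℕ => v) ((Vd.proj j).vertexMap x) ∧ (Vd.act j c).hom.vertexMap x = x := by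
    intro j n
    obtain ⟨x, hx, hfix⟩ := hfar (max n (N j)) j
    refine ⟨x, le_trans (le_max_left _ _) hx, ?_⟩
    change (Dg.treeAct hc j c).hom.vertexMap x = x
    rw [hact j (max n (N j)) (le_max_right _ _)]
    exact hfix
  have hcrit_c : ∀ n : ℕ, ∃ j₀ : Vd.J, ∀ j, j₀ ≤ j →
      ∀ (v : (Vd.tree j).Vertex) (b b' : (Vd.tree j).Branch),
        (Vd.tree j).abuts b = some v → (Vd.tree j).abuts b' = some v →
        (fun v : ℕ => v) ((Vd.proj j).vertexMap v) = n + 1 →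
        (Vd.act j c).hom.edgeMap ((Vd.tree j).edgeOf b) = (Vd.tree j).edgeOf b →
        (Vd.act j c).hom.edgeMap ((Vd.tree j).edgeOf b') = (Vd.tree j).edgeOf b' →
        (∃ (b₂ : (Vd.tree j).Branch) (v₂ : (Vd.tree j).Vertex), b₂ ≠ b ∧
          (Vd.tree j).edgeOf b₂ = (Vd.tree j).edgeOf b ∧ (Vd.tree j).abuts b₂ = some v₂ ∧
          (fun v : ℕ => v) ((Vd.proj j).vertexMap v₂) = n + 2) →
        (∃ (b₂ : (Vd.tree j).Branch) (v₂ : (Vd.tree j).Vertex), b₂ ≠ b' ∧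
          (Vd.tree j).edgeOf b₂ = (Vd.tree j).edgeOf b' ∧ (Vd.tree j).abuts b₂ = some v₂ ∧
          (fun v : ℕ => v) ((Vd.proj j).vertexMap v₂) = n) → False := by
    intro n
    obtain ⟨j₀, hj₀⟩ := hcrit n
    refine ⟨j₀, fun j hj y b b' hb hb' hy he he' hup hdown => ?_⟩
    obtain ⟨N', hN'⟩ := hj₀ j hj
    have hk : N' ≤ max N' (N j) := le_max_left _ _
    change (Dg.treeAct hc j c).hom.edgeMap _ = _ at he
    change (Dg.treeAct hc j c).hom.edgeMap _ = _ at he'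
    rw [hact j (max N' (N j)) (le_max_right _ _)] at he he'
    exact hN' _ hk y b b' hb hb' hy he he' hup hdown
  -- height escape of `c` and the escape of `C`
  have hheight := Vd.height_unbounded_of_criticalFree (fun v : ℕ => v) SemiGraph.ray_heightStep c hfar_c hcrit_c
  have hesc := Vd.escaping_of_height_unbounded ((Subgroup.zpowers c).topologicalClosure) c hcC
    (fun v : ℕ => v) hheight
  -- orders: the far apartment edge generators have the order of `ρ_n c`
  have hcover := Dg.cover_sameComponent hc
  have htrans := Dg.cover_htrans hc
  have hord_apt : ∀ (n m : ℕ), N n ≤ m →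
      ∀ y : ((Dg.cover hc n).SV (m + 1)).obj.V,
        orderOf ((Dg.cover hc n).ptHom (hcover n) (htrans n) y (T.brHom (m, true) (m + 1) (thetaRay_hap m) e₀)) =
          orderOf (Dg.proj hc n c) := by
    intro n m hm y
    set P := rayPointSeq (D := Dg) thetaRay_ham thetaRay_hap thetaRay_hmp P₀ (m + 1) with hP
    have h1 : (Dg.cover hc n).ptHom (hcover n) (htrans n) (P.pt n) (T.brHom (m, true) (m + 1) (thetaRay_hap m) e₀) =
        Dg.proj hc n (z m) :=
      P.eq_gal n _ _ ((Dg.cover hc n).ptHom_apply (hcover n) (htrans n) (P.pt n) _)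
    have h2 : Dg.proj hc n c = Dg.proj hc n (z m) := hN n m hm
    rw [(Dg.cover hc n).orderOf_ptHom_eq_of_htrans (hcover n) (htrans n) y (P.pt n), h1]
    exact congrArg orderOf h2.symm
  -- for ANY branch at a far vertex `k > N n`
  have hord : ∀ (n : ℕ) (b : ℕ × Bool) (k : ℕ) (hb : T.graph.abuts b = some k), N n + 1 ≤ k →
      ∀ y : ((Dg.cover hc n).SV k).obj.V,
        orderOf ((Dg.cover hc n).ptHom (hcover n) (htrans n) y (T.brHom b k hb e₀)) =
          orderOf (Dg.proj hc n c) := by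
    rintro n ⟨j, _ | _⟩ k hb hk y
    · -- `b = (j, false)`: `k = j`; read the order on the edge point and through the OTHER branch `(j, true)`
      have hjk : j = k := Option.some.inj ((thetaRay_ham (G := G) (E := E) (up := up) (low := low) j).symm.trans hb)
      subst hjk
      set yE : ((Dg.cover hc n).SE j).obj.V := ((Dg.cover hc n).glue (j, false) j hb).inv.hom.hom y with hyE
      have hy : ((Dg.cover hc n).glue (j, false) j hb).hom.hom.hom yE = y := (Dg.cover hc n).glue_hom_inv (j, false) j hb y
      set y' : ((Dg.cover hc n).SV (j + 1)).obj.V := ((Dg.cover hc n).glue (j, true) (j + 1) (thetaRay_hap j)).hom.hom.hom yE with hy'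
      have key : ∀ d : ℕ,
          (Dg.cover hc n).ptHom (hcover n) (htrans n) y (T.brHom (j, false) j hb e₀) ^ d = 1 ↔
            (Dg.cover hc n).ptHom (hcover n) (htrans n) y' (T.brHom (j, true) (j + 1) (thetaRay_hap j) e₀) ^ d = 1 := by
        intro d
        have h1 := (Dg.cover hc n).ptHom_brHom_pow_eq_one_iff_of_glue (hcover n) (htrans n) hb yE e₀ d
        rw [hy] at h1
        have h2 := (Dg.cover hc n).ptHom_brHom_pow_eq_one_iff_of_glue (hcover n) (htrans n) (thetaRay_hap j) yE e₀ d
        exact h1.trans h2.symm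
      rw [orderOf_eq_orderOf_iff.mpr key]
      exact hord_apt n j (by omega) y'
    · -- `b = (j, true)`: `k = j + 1`, an apartment-type branch
      have hjk : j + 1 = k := Option.some.inj ((thetaRay_hap (G := G) (E := E) (up := up) (low := low) j).symm.trans hb)
      subst hjk
      exact hord_apt n j (by omega) y
  -- the main claim
  refine ⟨(Subgroup.zpowers c).topologicalClosure, ⟨hC, fun K hKc hCK => ?_⟩, ⟨c, rfl⟩, fun v H hH hCH =>
    Vd.not_exists_verticial_of_le_of_escaping _ _ le_rfl hesc ⟨v, H, hH, hCH⟩⟩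
  refine le_antisymm (fun g hg => ?_) hCK
  apply Dg.mem_topologicalClosure_of_forall_proj hc
  intro n
  -- a far `K`-fixed vertex and edge at level `n`
  obtain ⟨x, β, hβx, hNx, -, hfixe⟩ := Vd.exists_forall_mem_fixed_far_edge_of_heightEscape' (fun v : ℕ => v)
    K hKc c (hCK hcC) hheight n (N n + 1)
  -- cover coordinates
  set β₀ := (Dg.treeIso hc n).inv.branchMap β with hβ₀
  have hβeq : β = (Dg.treeIso hc n).hom.branchMap β₀ := (Dg.treeIso_hom_branchMap_inv hc n β).symm
  set b : ℕ × Bool := β₀.1.1 with hbdef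
  set k : ℕ := (Dg.treeProj n).vertexMap x with hkdef
  have hb : T.graph.abuts b = some k := by
    have h1 := (Dg.treeProj n).abuts_branchMap β x hβx
    rwa [hβeq, Dg.treeProj_branchMap_treeIso hc] at h1
  -- every element of `K` fixes `β₀`
  have hKfix : ∀ q ∈ K.map (Dg.proj hc n), (CovObj.orbitGraphMap q.hom).branchMap β₀ = β₀ := by
    rintro _ ⟨g', hg', rfl⟩
    have hfixβ : (Dg.treeAct hc n g').hom.branchMap β = β := by
      refine SemiGraph.branchMap_eq_of_over_aut (Dg.treeProj n) (Dg.treeAct hc n g') (Dg.treeAct_over hc n g') β ?_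
      exact hfixe g' hg'
    rw [Dg.treeAct_apply hc, hβeq, Dg.galTreeAct_branchMap_treeIso hc] at hfixβ
    have h2 := congrArg (Dg.treeIso hc n).inv.branchMap hfixβ
    rwa [Dg.treeIso_inv_branchMap_hom hc, Dg.treeIso_inv_branchMap_hom hc] at h2
  obtain ⟨y, hyβ⟩ := (Dg.cover hc n).exists_eq_brOf b hb β₀ rfl
  rw [hyβ] at hKfix
  -- the squeeze: `ρ_n(K) = ⟨ρ_n c⟩`
  have hKeq : K.map (Dg.proj hc n) = Subgroup.zpowers (Dg.proj hc n c) :=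
    (Dg.cover hc n).eq_zpowers_of_forall_fix_brOf_of_orderOf_eq (hcover n) (htrans n) hb y e₀ hgen _ hKfix
      (Dg.proj hc n c) ⟨c, hCK hcC, rfl⟩ (hford n) (hord n b k hb hNx y)
  have hmem : Dg.proj hc n g ∈ Subgroup.zpowers (Dg.proj hc n c) := hKeq ▸ ⟨g, hg, rfl⟩
  rw [← MonoidHom.map_zpowers] at hmem
  obtain ⟨s, hs, hsg⟩ := hmem
  exact ⟨s, hs, hsg⟩

end Generic

/-! ### The countermodel `𝒢_θ(p, n)` -/

namespace ProfiniteSemiGraph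

open Literature.AnabelianGeometry.SemiGraphs.FreeProPRankTwo

variable (p : ℕ) [hp : Fact p.Prime] (n : ℕ → ℕ)

/-- `Thm37Hypotheses 𝒢_θ(p, n)` (re-assembled, as in the parent files). [cite: MochizukiSemiAnbd2006, Thm 3.7 p.40] -/
private theorem thm37θ' : (thetaRayFreeProP p n).Thm37Hypotheses :=
  thetaRayFreeProP_thm37Hypotheses p n
    (thetaRayFreeProP_isGaloisCountable p (α p) (α_ofAdd_one p) (fun m => θHom p m)
      (fun m => (θ p m).bijective) n)
    (thetaRayFreeProP_isQuasiCoherent p (α p) (α_ofAdd_one p) (fun m => θHom p m)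
      (fun m => (θ p m).bijective) n)
    (thetaRayFreeProP_isTotallyElevated_concrete p n)
    (thetaRayFreeProP_isTotallyAloof_concrete p n)
    (thetaRayFreeProP_isTotallyEstranged_concrete p n)

/-- **An explicit ANCHOR-FREE maximal compact subgroup of `π₁^temp(𝒢_θ(p, n))`**: for every schedule
`n_k → ∞`, the canonical tempered fundamental group of abc-iut-L3-d1's countermodel has a maximal compact subgroup
which is the CLOSURE OF A CYCLIC GROUP (procyclic — hence abelian, not slim, not verticial) and lies in no
verticial subgroup: the escaping `C = closure⟨lim_k z_k⟩` of the Thm 3.7 (iii) refutation is itself maximal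
compact. [cite: MochizukiSemiAnbd2006, Thm 3.7(iv) p.41] -/
theorem thetaRayFreeProP_exists_isMaximalCompact_procyclic (hn : Tendsto n atTop atTop)
    (h36 : (thetaRayFreeProP p n).Prop36Hypotheses) :
    ∃ C : Subgroup ((thetaRayFreeProP p n).temperedPiChart h36).G, IsMaximalCompactSubgroup C ∧
      (∃ c, C = (Subgroup.zpowers c).topologicalClosure) ∧
      ∀ (v : ℕ) (H : Subgroup ((thetaRayFreeProP p n).temperedPiChart h36).G),
        H ∈ verticialSubgroups ((thetaRayFreeProP p n).temperedPiChart h36) v → ¬ C ≤ H := by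
  classical
  haveI : NeZero p := ⟨hp.out.ne_zero⟩
  have h37 : (thetaRayFreeProP p n).Thm37Hypotheses := thm37θ' p n
  obtain ⟨P₀⟩ := thetaRay_nonempty_pointSeq_zero (G := Grp p) (E := Multiplicative ℤ_[p]) (up := α p)
    (low := fun k => θα p (n k)) h36
  have hsc : (thetaRayFreeProP p n).IsStrictlyCoherent :=
    thetaRayFreeProP_isStrictlyCoherent p (α p) (α_ofAdd_one p) (fun m => θHom p m)
      (fun m => (θ p m).bijective) n
  have hcoin : ∀ d : ℕ, ∃ N : ℕ, ∀ k, N ≤ k →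
      ((fun k => θα p (n k)) (k + 1) (ofAdd (1 : ℤ_[p])))⁻¹ * α p (ofAdd 1) ∈ charOpenCore (Grp p) d :=
    FreeProPRankTwo.hcoin_concrete p n hn
  have hχA : ∀ (m k : ℕ) (t : Multiplicative ℤ_[p]),
      χaMod p (n (m + 1) + 1) ((fun k => θα p (n k)) k t) = χaMod p (n (m + 1) + 1) (α p t) := by
    intro m k t
    change χaMod p _ (θ p (n k) (α p t)) = χaMod p _ (α p t)
    rw [χaMod_θ]
  have hK : ∀ m : ℕ, ∃ j₀ : ℕ, ∀ j, j₀ ≤ j → ∀ (w : ℕ)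
      (P : ((thetaRayFreeProP p n).galoisLevelData h36).PointSeq h37.isCountable w) (x : Grp p),
      P.gal j x = 1 → (abMod p (n (m + 1) + 1)).toMonoidHom x = 1 := by
    intro m
    obtain ⟨j₀, hj₀⟩ := (thetaRayFreeProP p n).exists_level_hK h36 hsc (p ^ (2 * (n (m + 1) + 1)))
    exact ⟨j₀, fun j hj w P x hx =>
      hj₀ j hj w P (abMod p (n (m + 1) + 1)).toMonoidHom (charOpenCore_le_ker_abMod p _) x hx⟩
  have hsep : ∀ (m : ℕ) (t₁ t₂ : Multiplicative ℤ_[p]),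
      χaMod p (n (m + 1) + 1) ((fun k => θα p (n k)) (m + 1) t₁) = χaMod p (n (m + 1) + 1) (α p (ofAdd 1)) →
      χaMod p (n (m + 1) + 1) (α p t₂) = χaMod p (n (m + 1) + 1) (α p (ofAdd 1)) →
      (abMod p (n (m + 1) + 1)).toMonoidHom ((fun k => θα p (n k)) (m + 1) t₁) ≠
        (abMod p (n (m + 1) + 1)).toMonoidHom (α p t₂) := by
    intro m t₁ t₂ h₁ h₂
    exact abMod_θ_α_ne_abMod_α_of_lt p (Nat.lt_succ_self _) t₁ t₂ h₁ h₂
  exact thetaRay_exists_isMaximalCompact_procyclic_forall_not_le_verticial_of_characters (G := Grp p)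
    (E := Multiplicative ℤ_[p]) (up := α p) (low := fun k => θα p (n k))
    (A := fun m => Multiplicative (ZMod (p ^ (n (m + 1) + 1))))
    (V := fun m => Multiplicative (ZMod (p ^ (n (m + 1) + 1)) × ZMod (p ^ (n (m + 1) + 1))))
    h37 P₀ (ofAdd 1) (topologicalClosure_zpowers_ofAdd_one p) hcoin (fun m => χaMod p (n (m + 1) + 1)) hχA
    (fun m => (abMod p (n (m + 1) + 1)).toMonoidHom) hK hsep

/-- The dominating schedules of the parent refutations (`p = 2`, `n k = k + 1` included) are covered.
[cite: MochizukiSemiAnbd2006, Thm 3.7(iv) p.41] -/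
theorem thetaRayFreeProP_exists_isMaximalCompact_procyclic_of_le (hn : ∀ k, k ≤ n k)
    (h36 : (thetaRayFreeProP p n).Prop36Hypotheses) :
    ∃ C : Subgroup ((thetaRayFreeProP p n).temperedPiChart h36).G, IsMaximalCompactSubgroup C ∧
      (∃ c, C = (Subgroup.zpowers c).topologicalClosure) ∧
      ∀ (v : ℕ) (H : Subgroup ((thetaRayFreeProP p n).temperedPiChart h36).G),
        H ∈ verticialSubgroups ((thetaRayFreeProP p n).temperedPiChart h36) v → ¬ C ≤ H :=
  thetaRayFreeProP_exists_isMaximalCompact_procyclic p n (tendsto_atTop_mono hn tendsto_id) h36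

end ProfiniteSemiGraph

end Literature.AnabelianGeometry.SemiGraphs

end
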